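import Summits.Ventures.LatticeQCDFlow.Scaling.SwapLadderIndexTauIntCritGap
import Summits.Ventures.LatticeQCDFlow.Scaling.SwapLadderIndexTauIntThresholdPoints
import Summits.Ventures.LatticeQCDFlow.Scaling.SwapAcceptanceOptimum

/-!
HONEST FRAMING: exact (Metropolis-corrected) sampling algorithms for lattice gauge theory; figures
of merit are autocorrelation/cost numbers at stated couplings and volumes; no continuum-physics
claim.

# SwapLadderIndexTauIntThresholdCard — THE CARD'S THREE LADDERS ARE ABOVE THE COLLAPSE THRESHOLD:
# `Λ_c(7) ≤ 2√2·2.5`, `Λ_c(12) ≤ 2√2·4.6`, `Λ_c(19) ≤ 2√2·8.3`, EACH BELOW HALF THE FLAT-`20 %` STIFFNESS `K·2√2·u₂₀`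
# (row 22 `su3-ptbc`, GEN-8, ours; sequel of `SwapLadderIndexTauIntCritGap` + `SwapLadderIndexTauIntThresholdPoints`)

Venture `LatticeQCDFlow` (cell pub-lqcd), topic `Scaling`; FANOUT row 22 (`su3-ptbc`).  NEW WORK of the cell over
`SwapLadderIndexTauIntCritGap` (`critGap`, `critGap_le`, `critGap_mono`, `critGap_of_le_one`, `maxPassageWeight`,
`thresholdStiffness` =: `Λ_c`), `SwapLadderIndexTauIntThresholdPoints` (the seven certified points `ray_point_*`:
`R·G′(0) ≤ G′(2√2·x)`) and GEN-4's `SwapAcceptanceOptimum` (`uTwenty`: `erfc u₂₀ = 1/5`, `0.9 < u₂₀ < 1`).  Nothing is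
cited as a fact; no `native_decide`.

THE POINT (model statements, value-free).  The card runs PTBC with `N_r = 8, 13, 20` replicas (`K = 7, 12, 19` gaps) tuned to a
flat `20 %` swap acceptance, i.e. — in the Gaussian swap model — every gap equals `ℓ₂₀ = 2√2·u₂₀` (`gaussAcc ℓ₂₀ = erfc u₂₀
= 1/5`) and the total stiffness is `Λ = K·ℓ₂₀`.  `SwapLadderIndexTauIntThreshold` proves that a positive `τ_int`-optimal
ladder exists iff `Λ > Λ_c(K) = Σ_j critGap((w_max/w_j)²)`.  Here the three thresholds are bounded term by term
(`critGap_le_ray_of_le`: `R ≤ R'` and `R'·G′(0) ≤ G′(2√2·x)` give `critGap R ≤ 2√2·x`; the ratios `(w_max/w_j)²` are the exact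
rationals `(16/w_j)²`, `(42/w_j)²`, `(100/w_j)²`):
* **`thresholdStiffness_seven_le`**: `Λ_c(7) ≤ 2√2·(0.85 + 0.3 + 0.1 + 0 + 0.1 + 0.3 + 0.85) = 2√2·2.5`;
* **`thresholdStiffness_twelve_le`**: `Λ_c(12) ≤ 2√2·2(1 + 0.6 + 0.3 + 0.3 + 0.1) = 2√2·4.6`;
* **`thresholdStiffness_nineteen_le`**: `Λ_c(19) ≤ 2√2·2(1.4 + 0.85 + 0.6 + 0.4 + 0.3 + 0.3 + 0.1 + 0.1 + 0.1) = 2√2·8.3`;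
* **`thresholdStiffness_lt_half_flat_twenty_{seven,twelve,nineteen}`**: since `u₂₀ > 0.9`, each is `< K·ℓ₂₀/2` — the
  card's three ladders sit at MORE THAN TWICE the collapse threshold, so (with `SwapLadderIndexTauIntThreshold`,
  `…OptimumShape`, and the staged `…OptimumUnique`) the model's `τ_int`-optimal ladder at each of the card's points EXISTS,
  is unique, mirror-symmetric and middle-tight; GEN-7's desk trade-off (`−19 %` index `τ_int` for `+43 %` round trip at
  S2) refers to a genuine optimum.
Desk values for comparison (NOT certified): `Λ_c = 5.43, 10.92, 19.35` vs `K·ℓ₂₀ = 17.9, 30.8, 48.7`.  NOT CLAIMED: anything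
about PTBC itself or a run; that tuning for the index `τ_int` is advisable (GEN-7: it lengthens round trips).
-/

noncomputable section

open Finset Real
open Literature.ComputerArithmetic.BrentZimmermann2010.AsymptoticExpansions (erfc)

namespace Summit.Ventures.LatticeQCDFlow.Scaling

/-! ## Term-by-term bounds and the three thresholds -/

/-- `R·G′(0) ≤ G′(2√2·x)` with `x ≥ 0` gives `critGap R ≤ 2√2·x`. [ours] -/
theorem critGap_le_ray {R x : ℝ} (hx : 0 ≤ x) (h : R * deriv gaussInvAcc 0 ≤ deriv gaussInvAcc (2 * sqrt 2 * x)) :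
    critGap R ≤ 2 * sqrt 2 * x :=
  critGap_le (by positivity) h

/-- Monotone form: `R ≤ R'` and `R'·G′(0) ≤ G′(2√2·x)` give `critGap R ≤ 2√2·x`. [ours] -/
theorem critGap_le_ray_of_le {R R' x : ℝ} (hRR' : R ≤ R') (hx : 0 ≤ x)
    (h : R' * deriv gaussInvAcc 0 ≤ deriv gaussInvAcc (2 * sqrt 2 * x)) : critGap R ≤ 2 * sqrt 2 * x :=
  (critGap_mono hRR').trans (critGap_le_ray hx h)

/-- **`Λ_c(7) ≤ 2√2·2.5`** (`w = 7, 12, 15, 16, 15, 12, 7`, `w_max = 16`). [ours] -/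
theorem thresholdStiffness_seven_le : thresholdStiffness 7 ≤ 2 * sqrt 2 * (5 / 2) := by
  unfold thresholdStiffness
  simp only [sum_range_succ, sum_range_zero, maxPassageWeight, passageWeight]
  norm_num
  have h0 : critGap (256 / 49) ≤ 2 * sqrt 2 * (17 / 20) := critGap_le_ray_of_le (by norm_num) (by norm_num) ray_point_085
  have h1 : critGap (16 / 9) ≤ 2 * sqrt 2 * (3 / 10) := critGap_le_ray_of_le (by norm_num) (by norm_num) ray_point_03
  have h2 : critGap (256 / 225) ≤ 2 * sqrt 2 * (1 / 10) :=
    critGap_le_ray_of_le (by norm_num) (by norm_num) ray_point_01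
  have h3 : critGap 1 = 0 := critGap_of_le_one le_rfl
  linarith

/-- **`Λ_c(12) ≤ 2√2·4.6`** (`w = 12, 22, 30, 36, 40, 42, 42, 40, 36, 30, 22, 12`, `w_max = 42`). [ours] -/
theorem thresholdStiffness_twelve_le : thresholdStiffness 12 ≤ 2 * sqrt 2 * (23 / 5) := by
  unfold thresholdStiffness
  simp only [sum_range_succ, sum_range_zero, maxPassageWeight, passageWeight]
  norm_num
  have h0 : critGap (49 / 4) ≤ 2 * sqrt 2 * 1 := critGap_le_ray_of_le le_rfl (by norm_num) ray_point_one
  have h1 : critGap (441 / 121) ≤ 2 * sqrt 2 * (3 / 5) := critGap_le_ray_of_le (by norm_num) (by norm_num) ray_point_06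
  have h2 : critGap (49 / 25) ≤ 2 * sqrt 2 * (3 / 10) := critGap_le_ray_of_le (by norm_num) (by norm_num) ray_point_03
  have h3 : critGap (49 / 36) ≤ 2 * sqrt 2 * (3 / 10) := critGap_le_ray_of_le (by norm_num) (by norm_num) ray_point_03
  have h4 : critGap (441 / 400) ≤ 2 * sqrt 2 * (1 / 10) :=
    critGap_le_ray_of_le (by norm_num) (by norm_num) ray_point_01
  have h5 : critGap 1 = 0 := critGap_of_le_one le_rfl
  linarith

/-- **`Λ_c(19) ≤ 2√2·8.3`** (`w = 19, 36, 51, 64, 75, 84, 91, 96, 99, 100, …`, `w_max = 100`). [ours] -/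
theorem thresholdStiffness_nineteen_le : thresholdStiffness 19 ≤ 2 * sqrt 2 * (83 / 10) := by
  unfold thresholdStiffness
  simp only [sum_range_succ, sum_range_zero, maxPassageWeight, passageWeight]
  norm_num
  have h0 : critGap (10000 / 361) ≤ 2 * sqrt 2 * (7 / 5) :=
    critGap_le_ray_of_le (by norm_num) (by norm_num) ray_point_14
  have h1 : critGap (625 / 81) ≤ 2 * sqrt 2 * (17 / 20) :=
    critGap_le_ray_of_le (by norm_num) (by norm_num) ray_point_085
  have h2 : critGap (10000 / 2601) ≤ 2 * sqrt 2 * (3 / 5) :=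
    critGap_le_ray_of_le (by norm_num) (by norm_num) ray_point_06
  have h3 : critGap (625 / 256) ≤ 2 * sqrt 2 * (2 / 5) := critGap_le_ray_of_le (by norm_num) (by norm_num) ray_point_04
  have h4 : critGap (16 / 9) ≤ 2 * sqrt 2 * (3 / 10) := critGap_le_ray_of_le (by norm_num) (by norm_num) ray_point_03
  have h5 : critGap (625 / 441) ≤ 2 * sqrt 2 * (3 / 10) :=
    critGap_le_ray_of_le (by norm_num) (by norm_num) ray_point_03
  have h6 : critGap (10000 / 8281) ≤ 2 * sqrt 2 * (1 / 10) :=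
    critGap_le_ray_of_le (by norm_num) (by norm_num) ray_point_01
  have h7 : critGap (625 / 576) ≤ 2 * sqrt 2 * (1 / 10) :=
    critGap_le_ray_of_le (by norm_num) (by norm_num) ray_point_01
  have h8 : critGap (10000 / 9801) ≤ 2 * sqrt 2 * (1 / 10) :=
    critGap_le_ray_of_le (by norm_num) (by norm_num) ray_point_01
  have h9 : critGap 1 = 0 := critGap_of_le_one le_rfl
  linarith

/-! ## Against the flat-`20 %` stiffness `K·2√2·u₂₀` -/

/-- **`Λ_c(7) < 7·ℓ₂₀/2`** (`ℓ₂₀ = 2√2·u₂₀`, `u₂₀ > 0.9`). [ours] -/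
theorem thresholdStiffness_lt_half_flat_twenty_seven : thresholdStiffness 7 < 7 * (2 * sqrt 2 * uTwenty) / 2 := by
  have hu := uTwenty_mem_Ioo.1
  have hs : 0 < sqrt 2 := by positivity
  nlinarith [thresholdStiffness_seven_le]

/-- **`Λ_c(12) < 12·ℓ₂₀/2`** (S2). [ours] -/
theorem thresholdStiffness_lt_half_flat_twenty_twelve :
    thresholdStiffness 12 < 12 * (2 * sqrt 2 * uTwenty) / 2 := by
  have hu := uTwenty_mem_Ioo.1
  have hs : 0 < sqrt 2 := by positivity
  nlinarith [thresholdStiffness_twelve_le]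

/-- **`Λ_c(19) < 19·ℓ₂₀/2`** (P1). [ours] -/
theorem thresholdStiffness_lt_half_flat_twenty_nineteen :
    thresholdStiffness 19 < 19 * (2 * sqrt 2 * uTwenty) / 2 := by
  have hu := uTwenty_mem_Ioo.1
  have hs : 0 < sqrt 2 := by positivity
  nlinarith [thresholdStiffness_nineteen_le]

/-- The flat-`20 %` gap: `gaussAcc (2√2·u₂₀) = 1/5`. [ours] -/
theorem gaussAcc_flat_twenty : gaussAcc (2 * sqrt 2 * uTwenty) = 1 / 5 := by
  unfold gaussAcc
  have hs : (2 : ℝ) * sqrt 2 ≠ 0 := by positivity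
  rw [show 2 * sqrt 2 * uTwenty / (2 * sqrt 2) = uTwenty by field_simp]
  exact erfc_uTwenty

end Summit.Ventures.LatticeQCDFlow.Scaling

end
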